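import Summits.RiemannHypothesis.RiemannHypothesis.Theorems.SigmaLLocalIvic
import HarnessLib

/-!
# SigmaL / BC5 rung W0 — Σ_L on a window from "the zeros in the padded window are on the line" (RH-free)

Route `RiemannHypothesis/HardyZLehmerSplit`, item `SigmaL` (stmt-RiemannHypothesis-24253), tribunal seat
`rh-trib-w-sigmaL-1` (bc5-witness planner; registered stub `SigmaL_rung_W0`). NOTHING HERE PROVES OR
ASSUMES RH: the rung is a decidable instance of Σ_L OUTSIDE RH's verified range, obtained from the
certified-computation theorem `stub_onLine_W0` (`Theorems/SigmaLOnLineW0.lean`: every zero of `ζ` with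
ordinate in `(H₀ + 19, H₀ + 40)` is on the critical line — Riemann–Siegel interval arithmetic + Turing's
method, `native_decide`) by the RH-free local Ivić theorem (`Theorems/SigmaLLocalIvic.lean`), re-filed from
the crux workfile `Cruxes/SigmaL/Lines/rung.lean` §4–§6 (commit 08d91a8805b9):

* §4 `noViolation_of_strictAnti` — no Lehmer violation where `Z'/Z` decreases on zero-free intervals;
* §5 `zetaZeroCount_lt_add_eight` — RH-free: for `3·10¹² ≤ t ≤ 3.9·10¹² − 8` a zero with ordinate in
  `(t, t + 8]` (explicit Riemann–von Mangoldt `abs_zetaZeroCount_sub_main_le_explicit`);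
* §6 `noViolationOn_of_onLine` — Σ_L on `(A, B)` from "zeros with ordinate in `(A − ½, B + 8]` are on the
  line" alone, `3·10¹² ≤ A`;
(the rung itself, `SigmaL_rung_W0` on `(H₀ + 20, H₀ + 30)`, is `Theorems/SigmaLRungW0.lean` = this + the certified
computation `SigmaLCert.stub_onLine_W0`.)

References: Ivić 2003 §2 Prop. 1 (arXiv:math/0311162) [Ivic2003]; Trudgian 2014 [Trudgian2014];
Brent 1979 Thm 3.2 [Brent1979].
-/

noncomputable section

set_option linter.dupNamespace false
set_option autoImplicit false

open Complex Filter Set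
open scoped Real Topology ComplexConjugate
open Literature.NumberTheory.LFunctions

namespace Summit.RiemannHypothesis.RiemannHypothesis.Theorems.SigmaLRung

/-! ## §4. No Lehmer violation from the decrease of `Z'/Z` (Ivić's contradiction, localised) -/

/-- A continuous function with `0 < g t` keeps its sign on a ball around `t`. [folklore] -/
theorem exists_ball_pos {g : ℝ → ℝ} (hg : Continuous g) {t : ℝ} (ht : 0 < g t) :
    ∃ δ > 0, ∀ u : ℝ, dist u t < δ → 0 < g u :=
  Metric.eventually_nhds_iff.1 ((hg.continuousAt (x := t)).eventually (lt_mem_nhds ht))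

/-- **No wrong-sign extremum on `(A, B)`** if `Z'/Z` decreases strictly on every zero-free
`(a, a') ⊆ [A, B]`: at a positive local minimum `t`, `Z' > 0` just left of `t` (as `Z'/Z(u) >
Z'/Z(t) = 0` and `Z > 0`), so `Z` increases strictly up to `t` — contradiction; symmetrically for a
negative local maximum. (Tree `Ivic2003_prop1.no_lehmer_violation`, windowed.) -/
theorem noViolation_of_strictAnti {A B : ℝ}
    (hanti : ∀ a a' : ℝ, A ≤ a → a' ≤ B → (∀ t ∈ Ioo a a', hardyZ t ≠ 0) →
      StrictAntiOn (fun t ↦ deriv hardyZ t / hardyZ t) (Ioo a a')) :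
    ∀ t : ℝ, A < t → t < B →
      (IsLocalMin hardyZ t → hardyZ t ≤ 0) ∧ (IsLocalMax hardyZ t → 0 ≤ hardyZ t) := by
  intro t hAt htB
  refine ⟨fun hmin ↦ ?_, fun hmax ↦ ?_⟩
  · by_contra hpos
    push Not at hpos
    obtain ⟨δ, hδ, hδpos⟩ := exists_ball_pos continuous_hardyZ hpos
    set δ' : ℝ := min δ (min (t - A) (B - t)) with hδ'
    have hδ'pos : 0 < δ' := lt_min hδ (lt_min (by linarith) (by linarith))
    have hδ'le : δ' ≤ δ := min_le_left _ _
    have hδ'A : δ' ≤ t - A := (min_le_right _ _).trans (min_le_left _ _)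
    have hδ'B : δ' ≤ B - t := (min_le_right _ _).trans (min_le_right _ _)
    have hZpos : ∀ u ∈ Ioo (t - δ') (t + δ'), 0 < hardyZ u := fun u hu ↦
      hδpos u (by rw [Real.dist_eq, abs_lt]; constructor <;> linarith [hu.1, hu.2])
    have hanti' := hanti (t - δ') (t + δ') (by linarith) (by linarith) fun u hu ↦ (hZpos u hu).ne'
    have htmem : t ∈ Ioo (t - δ') (t + δ') := ⟨by linarith, by linarith⟩
    have hderiv0 : deriv hardyZ t = 0 := hmin.deriv_eq_zero
    have hder_pos : ∀ u ∈ Ioo (t - δ') t, 0 < deriv hardyZ u := by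
      intro u hu
      have hu' : u ∈ Ioo (t - δ') (t + δ') := ⟨hu.1, hu.2.trans htmem.2⟩
      have hlt : deriv hardyZ t / hardyZ t < deriv hardyZ u / hardyZ u := hanti' hu' htmem hu.2
      rw [hderiv0, zero_div] at hlt
      rcases div_pos_iff.1 hlt with hcase | hcase
      · exact hcase.1
      · exact absurd hcase.2 (not_lt.2 (hZpos u hu').le)
    have hmono : StrictMonoOn hardyZ (Ioc (t - δ') t) :=
      strictMonoOn_of_deriv_pos (convex_Ioc _ _) continuous_hardyZ.continuousOn
        (fun u hu ↦ hder_pos u (by rwa [interior_Ioc] at hu))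
    obtain ⟨ε, hε, hεmin⟩ := Metric.eventually_nhds_iff.1 hmin
    set y : ℝ := t - min ε δ' / 2 with hy
    have hmin' : 0 < min ε δ' := lt_min hε hδ'pos
    have hyε : dist y t < ε := by
      rw [Real.dist_eq, hy, show t - min ε δ' / 2 - t = -(min ε δ' / 2) by ring, abs_neg,
        abs_of_pos (by positivity)]
      linarith [min_le_left ε δ']
    have hymem : y ∈ Ioc (t - δ') t :=
      ⟨by rw [hy]; linarith [min_le_right ε δ'], by rw [hy]; linarith⟩
    have hlt : hardyZ y < hardyZ t :=
      hmono hymem ⟨by linarith, le_rfl⟩ (by rw [hy]; linarith)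
    exact absurd (hεmin hyε) (not_le.2 hlt)
  · by_contra hneg
    push Not at hneg
    have hneg' : 0 < -hardyZ t := by linarith
    obtain ⟨δ, hδ, hδneg⟩ := exists_ball_pos (continuous_hardyZ.neg) (t := t) (by simpa using hneg')
    set δ' : ℝ := min δ (min (t - A) (B - t)) with hδ'
    have hδ'pos : 0 < δ' := lt_min hδ (lt_min (by linarith) (by linarith))
    have hδ'le : δ' ≤ δ := min_le_left _ _
    have hδ'A : δ' ≤ t - A := (min_le_right _ _).trans (min_le_left _ _)
    have hδ'B : δ' ≤ B - t := (min_le_right _ _).trans (min_le_right _ _)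
    have hZneg : ∀ u ∈ Ioo (t - δ') (t + δ'), hardyZ u < 0 := fun u hu ↦ by
      have := hδneg u (by rw [Real.dist_eq, abs_lt]; constructor <;> linarith [hu.1, hu.2])
      simpa using this
    have hanti' := hanti (t - δ') (t + δ') (by linarith) (by linarith) fun u hu ↦ (hZneg u hu).ne
    have htmem : t ∈ Ioo (t - δ') (t + δ') := ⟨by linarith, by linarith⟩
    have hderiv0 : deriv hardyZ t = 0 := hmax.deriv_eq_zero
    have hder_neg : ∀ u ∈ Ioo (t - δ') t, deriv hardyZ u < 0 := by
      intro u hu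
      have hu' : u ∈ Ioo (t - δ') (t + δ') := ⟨hu.1, hu.2.trans htmem.2⟩
      have hlt : deriv hardyZ t / hardyZ t < deriv hardyZ u / hardyZ u := hanti' hu' htmem hu.2
      rw [hderiv0, zero_div] at hlt
      rcases div_pos_iff.1 hlt with hcase | hcase
      · exact absurd hcase.2 (not_lt.2 (hZneg u hu').le)
      · exact hcase.1
    have hmono : StrictAntiOn hardyZ (Ioc (t - δ') t) :=
      strictAntiOn_of_deriv_neg (convex_Ioc _ _) continuous_hardyZ.continuousOn
        (fun u hu ↦ hder_neg u (by rwa [interior_Ioc] at hu))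
    obtain ⟨ε, hε, hεmax⟩ := Metric.eventually_nhds_iff.1 hmax
    set y : ℝ := t - min ε δ' / 2 with hy
    have hmin' : 0 < min ε δ' := lt_min hε hδ'pos
    have hyε : dist y t < ε := by
      rw [Real.dist_eq, hy, show t - min ε δ' / 2 - t = -(min ε δ' / 2) by ring, abs_neg,
        abs_of_pos (by positivity)]
      linarith [min_le_left ε δ']
    have hymem : y ∈ Ioc (t - δ') t :=
      ⟨by rw [hy]; linarith [min_le_right ε δ'], by rw [hy]; linarith⟩
    have hlt : hardyZ t < hardyZ y :=
      hmono hymem ⟨by linarith, le_rfl⟩ (by rw [hy]; linarith)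
    exact absurd (hεmax hyε) (not_le.2 hlt)

/-! ## §5. A zero in every `(t, t+8]` at height `≈ 3·10¹²`, RH-free (explicit Riemann–von Mangoldt) -/

/-- **RH-free window count above height `3·10¹²`:** `N(t) < N(t+8)` for every `t ≥ 3·10¹²`,
from the tree's PROVED explicit bound `|N(T) − (T/2π) log(T/2πe)| ≤ 0.3083 log T + 4.128`
(`T ≥ 30`): the main term grows by `≥ (8/2π)(log t − log 2π − 1) > 1.26 (log t − 3)` over
`[t, t+8]` while the two errors total `≤ 0.3083 (2 log t + 0.7) + 8.256`; the difference is
`> 0.64 log t − 12.3 > 0` since `log t > 28`. -/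
theorem zetaZeroCount_lt_add_eight {t : ℝ} (ht : 3000000000000 ≤ t) :
    zetaZeroCount t < zetaZeroCount (t + 8) := by
  have h1 := abs_zetaZeroCount_sub_main_le_explicit (by linarith : (30 : ℝ) ≤ t)
  have h2 := abs_zetaZeroCount_sub_main_le_explicit (by linarith : (30 : ℝ) ≤ t + 8)
  rw [abs_le] at h1 h2
  have he := Real.exp_one_lt_d9
  have he' := Real.exp_one_gt_d9
  have hπ : π < 3.15 := Real.pi_lt_d2
  have hπpos := Real.pi_pos
  have ht0 : 0 < t := by linarith
  have hlogt : 28 < Real.log t := by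
    rw [Real.lt_log_iff_exp_lt ht0]
    calc Real.exp 28 = Real.exp 1 ^ 28 := by rw [Real.exp_one_pow]; norm_num
      _ < 2.7182818286 ^ 28 := by gcongr
      _ < 3000000000000 := by norm_num
      _ ≤ t := ht
  have hlog8 : Real.log (t + 8) ≤ Real.log t + 0.7 := by
    have h2t : t + 8 ≤ 2 * t := by linarith
    calc Real.log (t + 8) ≤ Real.log (2 * t) := Real.log_le_log (by linarith) h2t
      _ = Real.log 2 + Real.log t := Real.log_mul (by norm_num) ht0.ne'
      _ ≤ Real.log t + 0.7 := by linarith [Real.log_two_lt_d9]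
  have hlog2pi : Real.log (2 * π) < 2 := by
    rw [Real.log_lt_iff_lt_exp (by positivity)]
    calc 2 * π < 2 * 3.15 := by linarith
      _ < 2.7182818283 ^ 2 := by norm_num
      _ < Real.exp 1 ^ 2 := by gcongr
      _ = Real.exp 2 := by rw [Real.exp_one_pow]; norm_num
  set L₀ := Real.log (t / (2 * π * Real.exp 1)) with hL₀
  set L₈ := Real.log ((t + 8) / (2 * π * Real.exp 1)) with hL₈
  have hL₀eq : L₀ = Real.log t - Real.log (2 * π) - 1 := by
    rw [hL₀, Real.log_div ht0.ne' (by positivity), Real.log_mul (by positivity) (Real.exp_pos 1).ne',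
      Real.log_exp]
    ring
  have hL₈ge : L₀ ≤ L₈ := by
    rw [hL₀, hL₈]
    exact Real.log_le_log (by positivity) (div_le_div_of_nonneg_right (by linarith) (by positivity))
  have hL₀ge : Real.log t - 3 < L₀ := by rw [hL₀eq]; linarith
  have hL₀pos : 0 < L₀ := by linarith
  have hM : 8 / (2 * π) * L₀ ≤ (t + 8) / (2 * π) * L₈ - t / (2 * π) * L₀ := by
    have h3 : t / (2 * π) * L₀ ≤ t / (2 * π) * L₈ :=
      mul_le_mul_of_nonneg_left hL₈ge (by positivity)
    have h4 : 8 / (2 * π) * L₀ ≤ 8 / (2 * π) * L₈ :=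
      mul_le_mul_of_nonneg_left hL₈ge (by positivity)
    have e : (t + 8) / (2 * π) * L₈ = t / (2 * π) * L₈ + 8 / (2 * π) * L₈ := by ring
    rw [e]
    linarith
  have hcoef : (1.26 : ℝ) < 8 / (2 * π) := by
    rw [lt_div_iff₀ (by positivity)]
    nlinarith
  have hgain : 1.26 * (Real.log t - 3) < 8 / (2 * π) * L₀ :=
    calc 1.26 * (Real.log t - 3) < 1.26 * L₀ := by nlinarith
      _ < 8 / (2 * π) * L₀ := mul_lt_mul_of_pos_right hcoef hL₀pos
  have key : (zetaZeroCount t : ℝ) < zetaZeroCount (t + 8) := by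
    nlinarith [h1.2, h2.1, hM, hgain, hlog8, hlogt]
  exact_mod_cast key

/-- From `N(t) < N(t + C)`: a zero `ρ` of `ζ` with `t < Im ρ ≤ t + C` (counting boxes,
`Montgomery.zetaZeroCount_sub_eq_finsum`). RH-free. [folklore] -/
theorem exists_zero_of_count_lt {t C : ℝ} (hC : 0 ≤ C)
    (hlt : zetaZeroCount t < zetaZeroCount (t + C)) :
    ∃ ρ : ℂ, riemannZeta ρ = 0 ∧ t < ρ.im ∧ ρ.im ≤ t + C := by
  have hsum := Montgomery.zetaZeroCount_sub_eq_finsum (show t ≤ t + C by linarith)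
  have hpos : (0 : ℤ) < ∑ᶠ ρ ∈ zetaZeroBox 0 (t + C) \ zetaZeroBox 0 t, riemannZetaZeroOrder ρ := by
    rw [← hsum]
    have : (zetaZeroCount t : ℤ) < zetaZeroCount (t + C) := by exact_mod_cast hlt
    linarith
  have hne : (zetaZeroBox 0 (t + C) \ zetaZeroBox 0 t).Nonempty := by
    by_contra h0
    rw [Set.not_nonempty_iff_eq_empty] at h0
    rw [h0, finsum_mem_empty] at hpos
    exact lt_irrefl _ hpos
  obtain ⟨ρ, ⟨hζ, h0, h1, him, hle⟩, hnot⟩ := hne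
  have hgt : t < ρ.im := by
    by_contra hle'
    exact hnot ⟨hζ, h0, h1, him, not_lt.1 hle'⟩
  exact ⟨ρ, hζ, hgt, hle⟩

/-- Critical zeros within `8` of every point of `(A, B)` (`A ≥ 3·10¹²`), from the window count and
the on-line hypothesis on `(A', B') ⊇ (A, B + 8]`. RH-free given the window hypothesis. -/
theorem criticalZeroWithin_of_onLine {A B A' B' : ℝ} (hA : 3000000000000 ≤ A)
    (hA' : A' ≤ A) (hB' : B + 8 ≤ B')
    (hline : ∀ s : ℂ, riemannZeta s = 0 → A' < s.im → s.im < B' → s.re = 1 / 2) :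
    ∀ t : ℝ, A < t → t < B → ∃ γ : ℝ, t < γ ∧ γ ≤ t + 8 ∧ riemannZeta (1 / 2 + (γ : ℂ) * I) = 0 := by
  intro t hAt htB
  obtain ⟨ρ, hζ, hgt, hle⟩ := exists_zero_of_count_lt (by norm_num)
    (zetaZeroCount_lt_add_eight (by linarith : (3000000000000 : ℝ) ≤ t))
  have hre : ρ.re = 1 / 2 := hline ρ hζ (by linarith) (by linarith)
  refine ⟨ρ.im, hgt, hle, ?_⟩
  have e : (1 / 2 : ℂ) + (ρ.im : ℂ) * I = ρ := by
    apply Complex.ext <;> simp [hre]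
  rw [e]; exact hζ

/-! ## §6. Σ_L on a window from "RH in the padded window" alone -/

/-- **Σ_L on `(A, B)` from the zeros with ordinate in `(A', B') ⊇ (A − ½, B + 8]` being on the
line** (`3·10¹² ≤ A`, any `B`): `localIvic` with `C₀ = 8` (`4·8² = 256 < A`) +
`criticalZeroWithin_of_onLine` + `noViolation_of_strictAnti`. RH-free given the window hypothesis;
nothing here bears on the truth of RH. -/
theorem noViolationOn_of_onLine {A B A' B' : ℝ} (hA : 3000000000000 ≤ A)
    (hA' : A' ≤ A - 1 / 2) (hB' : B + 8 ≤ B')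
    (hline : ∀ s : ℂ, riemannZeta s = 0 → A' < s.im → s.im < B' → s.re = 1 / 2) :
    ∀ t : ℝ, A < t → t < B →
      (IsLocalMin hardyZ t → hardyZ t ≤ 0) ∧ (IsLocalMax hardyZ t → 0 ≤ hardyZ t) := by
  have hnear := criticalZeroWithin_of_onLine hA (by linarith) hB' hline
  refine noViolation_of_strictAnti fun a a' ha ha' hfree ↦ ?_
  exact localIvic (C₀ := 8) (by linarith) (by linarith) hA' (by linarith : B + 1 / 2 ≤ B') hline
    hnear ha ha' hfree

end Summit.RiemannHypothesis.RiemannHypothesis.Theorems.SigmaLRung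

end
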